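import Summits.ResolutionOfSingularities.ResolutionOfSingularities.Theorems.PurelyInseparableDim4WinCertLeafE5Fast17
import HarnessLib
import HarnessLib.Audit.Tags

/-!
# Purely inseparable fourfolds — F4-C kernel half OVER EVERY FIELD OF CHARACTERISTIC 2 by FLATS + IMPLICIT LEAVES
# (FCert v3 TORUS form: leaf kinds substitution, norm, Laurent, GCD, GCD with constants; still and TORUS flats; `.mono`/`.rat` blind rows), batch E5: 1 D ≤ 4 band roots are IN-SCOPE ESCAPABLE over every
# field `K` of characteristic 2

ROOTS (RUN 4b ids): S1a-5637307d28.
Census cell «res-dim4-pi» (D-0157 DOOR 2), desk WORD #164 (b) «∀K RESIDUE»; seat res-rescue-typ-3 g10 (rescue base,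
harness successor of g9 whose loan ran under director-resolution DR-E8 (4) / DR-E9); a DATA file for `PurelyInseparableDim4WinCertLeaf` / `…WinCertLeafSound` /
`…WinCertLeafKinds` (`LCert`, oracle-parametrised kernel-reducible checker `twinCertBL 2 2 leafOK5`,
`forall_inScopeStateWins_of_twinCertBL5`; leaf lemmas = res-dim4-p-8 g3's `substBlindB` (`…ScopeBlindSubstCert`) and
`normLeafB` (`…ScopeBlindNormLeaf`); flat absorption = res-rescue-typ-3 g8's `…FlatAbsorb`).  None of these roots is in
the ∀K column of record before this series.
FORMAT: per root one certificate = rows `((⟨F, r, exc⟩, S, blindness certificate?), cover witnesses, flats, leaves)`,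
root first, children later; long certificates split into blocks checked by `lwinCertBL_append_of`.  Leaves are
IMPLICIT: `⟨j, gens, opens, cert⟩` — the `K`-points `b` of chart `j` with `g(b) = 0` for `g ∈ gens` (and `a(b) ≠ 0` for
`a ∈ opens`, empty here); `cert` = `.subst σ T α₀` (σ a polynomial retraction over `𝔽₂` killing `J₂⁺` of the chart
transform) or `.norm T u v α₀` (the `𝔽₄`-conjugate plane pair `x_T = 0, x_u² + x_u x_v + x_v² = 0`); in both cases EVERY
`K`-point of the leaf gives a child OUT of coordinate scope, so the leaf needs no subtree.  Cover witnesses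
`Σ g_α·D^{{(α)}}G + h·x_j = ((x_i² − x_i)·Π (x_t − b0_t)·Π g_r)^N` for every `i ≠ j` and every choice of one fixed
coordinate per flat and one closed condition `g_r` per leaf.  How the data was made (seat instruments
`work/allk/resolve5.py` + `fcert7.py` + `emit_lcert_lean.py`, centre order «large centres first», scaffolding only — what is certified is the kernel re-check):
∀K-restricted game search with budget deepening (smallest winning tree first), cover checked over `𝔽₁₆` during search,
witnesses by GF(2) linear algebra, identities re-verified term by term.
CERTIFIED: `twinCertBL 2 2 leafOK5` on every certificate ⇒ **`forall_inScopeStateWins_lcertsE5`**: for EVERY field `K`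
of characteristic 2, every row state `⊗ K` — in particular each of the 1 roots — is IN-SCOPE ESCAPABLE
(`InScopeStateWins 2`, player B over ALL of `K⁴`).  NOT CERTIFIED: anything about other roots; F4-C(2,2) as a statement
(`TerminatesInScope 2 2` stays OPEN); the full game; resolution of anything.  [OURS · counted 0 · AI kernel work, weaker
than expert review.]  Nothing here proves resolution of singularities in dimension ≥ 4 / characteristic `p`.
bears_on: LADDER-RESOLUTION:D157-DOOR2 (res-dim4-pi · F4-C ∀K column · FCert v3 data). Supports stmt-ResolutionOfSingularities-16155 (helper).
-/

set_option linter.dupNamespace false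

noncomputable section

namespace Summit.ResolutionOfSingularities.ResolutionOfSingularities.Theorems.PIDim4

namespace WinCertLeaf

open StepKit WinCertSound InScopeWinCert ScopeBlind WinCertAllFields WinCertFlat WinCertSubst
/-- The certificate of root S1a-5637307d28 checks. [OURS · ‖ K] [folklore] -/
theorem lcE5r1_ok : twinCertBL 2 2 leafOK5 lcE5r1 = true := lcE5r1_ok1

/-- Every certificate of `lcertsE5` checks. [OURS · ‖ K] [folklore] -/
theorem lwinCertB_lcertsE5 : ∀ T ∈ lcertsE5, twinCertBL 2 2 leafOK5 T = true :=
  List.forall_mem_cons.mpr ⟨lcE5r1_ok, List.forall_mem_nil _⟩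

/-- **Over EVERY field `K` of characteristic 2, every row state of every certificate in `lcertsE5` — in particular each of the 1 roots — is IN-SCOPE ESCAPABLE** (`InScopeStateWins 2`: the F4-C game, player B ranging over all of `K⁴`). [OURS · ‖ K] [folklore] -/
theorem forall_inScopeStateWins_lcertsE5 (K : Type) [Field K] [CharP K 2] [DecidableEq K] :
    ∀ T ∈ lcertsE5, ∀ row ∈ T,
      InScopeStateWins 2 (⟨MvPolynomial.map (ZMod.castHom (dvd_refl 2) K) row.1.1.1.toState.F, row.1.1.1.toState.r,
        row.1.1.1.toState.exc⟩ : State K) :=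
  fun T hT => forall_inScopeStateWins_of_twinCertBL5 (lwinCertB_lcertsE5 T hT) K

/-- Root count of this file. [folklore] -/
theorem lcertsE5_length : lcertsE5.length = 1 := by decide

end WinCertLeaf

end Summit.ResolutionOfSingularities.ResolutionOfSingularities.Theorems.PIDim4

end
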